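import Literature.Topology.FourManifolds.GenericCircleStep
import HarnessLib

/-!
# A single circle in a manifold of dimension `≥ 3`: the generic perturbation step
# (Whitney 1936, §II Thm. 5 / §8; Milnor 1965, Lemma 6.12)

Topic `Literature/Topology/FourManifolds`; the time-independent companion of
`GenericCircleStep.lean`.  There a smooth one-parameter family of circles `G : ℝ × S¹ → V` is
perturbed, rectangle by rectangle, into a family of injective immersions when `dim V ≥ 4`
(bad parameters parametrised by `2` resp. `3` real variables).  For a *single* smooth circle
`g : S¹ → V` the same chart-affine perturbation `chartPerturb` (`CircleFamilies.lean`), now with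
a time-independent bump `angBump c α (2α)` on an arc, has bad parameters parametrised by `1`
resp. `2` real variables, so that `dim V ≥ 3` suffices — the dimension `2·1 + 1` of Whitney's
imbedding theorem for curves (H. Whitney, *Differentiable manifolds*, Ann. of Math. 37 (1936),
§II Thm. 5 and §8; the form used by Milnor, *Lectures on the h-cobordism theorem* (1965),
Lemma 6.12, PDF p. 42, in the proof of Lemma 8.3, PDF p. 56: *"Since `dim V = n - 1 ≥ 3`,
Whitney's theorem 6.12 provides a smooth imbedding"*).

* `Literature.Topology.FourManifolds.exists_chartPerturb_stagesGoodOn_const` — **the step**: for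
  `3 ≤ n`, a smooth `g : S¹ → V` whose constant family is good on `ℝ × B`
  (`StagesGoodOn`: nonzero velocity at the points of `B`, which are separated from all other
  points), an arc `circleClosedArc c (3α)` mapped into the source of the chart at `x`
  (`0 < α`, `3α < π/2`), and finitely many compact `C i ⊆ S¹` mapped into open `U i ⊆ V`,
  some parameter `q ∈ ℝⁿ × ℝⁿ` makes the perturbed circle smooth, good on
  `ℝ × (B ∪ circleClosedArc c α)`, still mapping `C i` into `U i`, and unchanged where the bump
  vanishes.

Everything here is proved; no definitions, no named facts.

## References

* H. Whitney, *Differentiable manifolds*, Ann. of Math. (2) 37 (1936), 645–680, §II Thm. 5,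
  §8. [Whitney1936]
* J. Milnor, *Lectures on the h-cobordism theorem* (1965), Lemma 6.12 (PDF p. 42) and proof of
  Lemma 8.3 (PDF p. 56). [MilnorHCobordism1965]
* M. W. Hirsch, *Differential Topology*, GTM 33 (1976), Ch. 3 §2 Thm. 2.5. [HirschDT1976]
-/

open scoped Manifold ContDiff Topology Real
open Function Set Filter
open _root_.MeasureTheory _root_.MeasureTheory.Measure

noncomputable section

namespace Literature.Topology.FourManifolds

variable {n : ℕ} {V : Type*} [TopologicalSpace V] [ChartedSpace (EuclideanSpace ℝ (Fin n)) V]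

/-! ### One-variable calculus along `circlePoint` -/

section OneVariable

/-- The derivative of the affine perturbation term along `θ`:
`(β • (v + ℓ • w))' = β' • v + (β' ℓ + β ℓ') • w`. [folklore] -/
theorem deriv_smul_add_smul {F : Type*} [NormedAddCommGroup F] [NormedSpace ℝ F]
    {β ℓ : ℝ → ℝ} {s : ℝ} (hβ : DifferentiableAt ℝ β s) (hℓ : DifferentiableAt ℝ ℓ s) (v w : F) :
    deriv (fun r => β r • (v + ℓ r • w)) s =
      deriv β s • v + (deriv β s * ℓ s + β s * deriv ℓ s) • w := by
  have h1 : (fun r => β r • (v + ℓ r • w)) = fun r => β r • v + (β * ℓ) r • w := by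
    funext r
    rw [smul_add, smul_smul, Pi.mul_apply]
  rw [h1]
  have hβv : HasDerivAt (fun r => β r • v) (deriv β s • v) s := hβ.hasDerivAt.smul_const v
  have hβℓ : HasDerivAt (β * ℓ) (deriv β s * ℓ s + β s * deriv ℓ s) s :=
    hβ.hasDerivAt.mul hℓ.hasDerivAt
  have hβℓw : HasDerivAt (fun r => (β * ℓ) r • w) ((deriv β s * ℓ s + β s * deriv ℓ s) • w) s :=
    hβℓ.smul_const w
  exact (hβv.add hβℓw).deriv

/-- The affine perturbation term is differentiable along `θ`. [folklore] -/
theorem differentiableAt_smul_add_smul_real {F : Type*} [NormedAddCommGroup F] [NormedSpace ℝ F]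
    {β ℓ : ℝ → ℝ} {s : ℝ} (hβ : DifferentiableAt ℝ β s) (hℓ : DifferentiableAt ℝ ℓ s) (v w : F) :
    DifferentiableAt ℝ (fun r => β r • (v + ℓ r • w)) s :=
  hβ.smul ((hℓ.smul_const w).const_add v)

/-- The lift of `angSin c` along `circlePoint`, one variable: `θ ↦ sin (θ - c)`. [folklore] -/
theorem angSin_comp_circlePoint (c : ℝ) :
    (fun θ : ℝ => angSin c (circlePoint θ)) = fun θ : ℝ => Real.sin (θ - c) :=
  funext fun θ => angSin_circlePoint c θ

/-- The lifted sine coordinate has derivative `cos (θ - c)`. [folklore] -/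
theorem hasDerivAt_angSin_comp_circlePoint (c s : ℝ) :
    HasDerivAt (fun θ : ℝ => angSin c (circlePoint θ)) (Real.cos (s - c)) s := by
  rw [angSin_comp_circlePoint]
  simpa [Function.comp_def] using (Real.hasDerivAt_sin (s - c)).comp s ((hasDerivAt_id s).sub_const c)

/-- The domain `{θ | g (circlePoint θ) ∈ chart source}` is open. [folklore] -/
theorem isOpen_setOf_comp_circlePoint_mem_source {g : (Metric.sphere (0 : EuclideanSpace ℝ (Fin 2)) 1) → V} (hg : Continuous g) (x : V) :
    IsOpen {θ : ℝ | g (circlePoint θ) ∈ (chartAt (EuclideanSpace ℝ (Fin n)) x).source} :=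
  (chartAt (EuclideanSpace ℝ (Fin n)) x).open_source.preimage (hg.comp continuous_circlePoint)

/-- The time-independent perturbation of a time-independent family is time-independent.
[folklore] -/
theorem chartPerturb_const_apply (g : (Metric.sphere (0 : EuclideanSpace ℝ (Fin 2)) 1) → V) (x : V) (β ℓ : (Metric.sphere (0 : EuclideanSpace ℝ (Fin 2)) 1) → ℝ) (q : EuclideanSpace ℝ (Fin n) × EuclideanSpace ℝ (Fin n))
    (t : ℝ) (u : (Metric.sphere (0 : EuclideanSpace ℝ (Fin 2)) 1)) :
    chartPerturb (fun p : ℝ × (Metric.sphere (0 : EuclideanSpace ℝ (Fin 2)) 1) => g p.2) x (fun p => β p.2) ℓ q (t, u) =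
      chartPerturb (fun p : ℝ × (Metric.sphere (0 : EuclideanSpace ℝ (Fin 2)) 1) => g p.2) x (fun p => β p.2) ℓ q (0, u) := rfl

/-- **Time-independent good stages, pointwise form**: the constant family of `g` is good on
`ℝ × B` iff `g` has nonzero velocity at the points of `B` and separates them from all other
points of the circle. [folklore] -/
theorem stagesGoodOn_const_iff {g : (Metric.sphere (0 : EuclideanSpace ℝ (Fin 2)) 1) → V} {B : Set ((Metric.sphere (0 : EuclideanSpace ℝ (Fin 2)) 1))} :
    StagesGoodOn n (fun p : ℝ × (Metric.sphere (0 : EuclideanSpace ℝ (Fin 2)) 1) => g p.2) (univ ×ˢ B) ↔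
      (∀ s : ℝ, circlePoint s ∈ B → thetaVel n (fun p : ℝ × (Metric.sphere (0 : EuclideanSpace ℝ (Fin 2)) 1) => g p.2) 0 s ≠ 0) ∧
        ∀ u u' : (Metric.sphere (0 : EuclideanSpace ℝ (Fin 2)) 1), u ∈ B → g u = g u' → u = u' := by
  constructor
  · rintro ⟨h1, h2⟩
    exact ⟨fun s hs => h1 0 s ⟨mem_univ _, hs⟩, fun u u' hu => h2 0 u u' ⟨mem_univ _, hu⟩⟩
  · rintro ⟨h1, h2⟩
    refine ⟨fun t s hts => ?_, fun t u u' htu => h2 u u' htu.2⟩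
    rw [thetaVel_eq_of_stage_eq (G := fun p : ℝ × (Metric.sphere (0 : EuclideanSpace ℝ (Fin 2)) 1) => g p.2) (t' := 0) (fun u => rfl) s]
    exact h1 s hts.2

variable [IsManifold (𝓡 n) ∞ V]

/-- **A smooth circle read in an extended chart is smooth along `circlePoint`**: for smooth
`g : S¹ → V`, `θ ↦ φ (g (circlePoint θ))` is `C^∞` (vector-space sense) on the open set where
`g (circlePoint θ)` lies in the source of the chart at `x`. [folklore] -/
theorem contDiffOn_extChartAt_comp_circlePoint {g : (Metric.sphere (0 : EuclideanSpace ℝ (Fin 2)) 1) → V} (hg : ContMDiff (𝓡 1) (𝓡 n) ∞ g)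
    (x : V) :
    ContDiffOn ℝ ∞ (fun θ : ℝ => extChartAt (𝓡 n) x (g (circlePoint θ)))
      {θ : ℝ | g (circlePoint θ) ∈ (chartAt (EuclideanSpace ℝ (Fin n)) x).source} := by
  rw [← contMDiffOn_iff_contDiffOn]
  have h1 : ContMDiffOn 𝓘(ℝ, ℝ) (𝓡 n) ∞ (fun θ : ℝ => g (circlePoint θ))
      {θ : ℝ | g (circlePoint θ) ∈ (chartAt (EuclideanSpace ℝ (Fin n)) x).source} :=
    (hg.comp contMDiff_circlePoint).contMDiffOn
  exact contMDiffOn_extChartAt.comp h1 fun θ hθ => hθ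

end OneVariable

/-! ### The generic step for a single circle -/

section Step

variable [IsManifold (𝓡 n) ∞ V]

/-- **The generic perturbation step for a single circle** (Whitney (1936), §II Thm. 5 and §8:
the case `m = 1`, `n ≥ 2m + 1 = 3`; Hirsch (1976), Ch. 3 §2 Thm. 2.5).  Let `3 ≤ n`,
`g : S¹ → V` a smooth circle whose constant family is good on `ℝ × B`, `circleClosedArc c (3α)`
mapped by `g` into the source of the chart at `x` (`0 < α`, `3α < π/2`), and finitely many
compact `C i ⊆ S¹` mapped by `g` into open `U i ⊆ V`.  Then for some `q ∈ ℝⁿ × ℝⁿ` the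
perturbed circle `u ↦ chartPerturb (fun p ↦ g p.2) x (fun p ↦ angBump c α (2α) p.2) (angSin c) q (0, u)`
is smooth, its constant family is good on `ℝ × (B ∪ circleClosedArc c α)`, it maps each `C i`
into `U i`, and it agrees with `g` wherever the bump vanishes.
[cite: Whitney1936, §II Thm. 5 and §8] -/
theorem exists_chartPerturb_stagesGoodOn_const (hn : 3 ≤ n) {g : (Metric.sphere (0 : EuclideanSpace ℝ (Fin 2)) 1) → V}
    (hg : ContMDiff (𝓡 1) (𝓡 n) ∞ g) {B : Set ((Metric.sphere (0 : EuclideanSpace ℝ (Fin 2)) 1))}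
    (hB : StagesGoodOn n (fun p : ℝ × (Metric.sphere (0 : EuclideanSpace ℝ (Fin 2)) 1) => g p.2) (univ ×ˢ B)) {c α : ℝ} (hα : 0 < α)
    (h3α : 3 * α < π / 2) {x : V}
    (hRc : MapsTo g (circleClosedArc c (3 * α)) (chartAt (EuclideanSpace ℝ (Fin n)) x).source)
    {ι : Type*} [Finite ι] {C : ι → Set ((Metric.sphere (0 : EuclideanSpace ℝ (Fin 2)) 1))} {U : ι → Set V} (hC : ∀ i, IsCompact (C i))
    (hU : ∀ i, IsOpen (U i)) (hCU : ∀ i, MapsTo g (C i) (U i)) :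
    ∃ q : EuclideanSpace ℝ (Fin n) × EuclideanSpace ℝ (Fin n),
      ContMDiff (𝓡 1) (𝓡 n) ∞ (fun u : (Metric.sphere (0 : EuclideanSpace ℝ (Fin 2)) 1) =>
        chartPerturb (fun p : ℝ × (Metric.sphere (0 : EuclideanSpace ℝ (Fin 2)) 1) => g p.2) x (fun p => angBump c α (2 * α) p.2) (angSin c)
          q (0, u)) ∧
      StagesGoodOn n (fun p : ℝ × (Metric.sphere (0 : EuclideanSpace ℝ (Fin 2)) 1) =>
        chartPerturb (fun p : ℝ × (Metric.sphere (0 : EuclideanSpace ℝ (Fin 2)) 1) => g p.2) x (fun p => angBump c α (2 * α) p.2) (angSin c)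
          q (0, p.2)) (univ ×ˢ (B ∪ circleClosedArc c α)) ∧
      (∀ i, MapsTo (fun u : (Metric.sphere (0 : EuclideanSpace ℝ (Fin 2)) 1) =>
        chartPerturb (fun p : ℝ × (Metric.sphere (0 : EuclideanSpace ℝ (Fin 2)) 1) => g p.2) x (fun p => angBump c α (2 * α) p.2) (angSin c)
          q (0, u)) (C i) (U i)) ∧
      ∀ u : (Metric.sphere (0 : EuclideanSpace ℝ (Fin 2)) 1), angBump c α (2 * α) u = 0 →
        chartPerturb (fun p : ℝ × (Metric.sphere (0 : EuclideanSpace ℝ (Fin 2)) 1) => g p.2) x (fun p => angBump c α (2 * α) p.2) (angSin c)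
          q (0, u) = g u := by
  have h2α : 2 * α ≤ π := by linarith [Real.pi_pos]
  have hcos2 : Real.cos (2 * α) < Real.cos α := cos_two_mul_lt_cos hα h2α
  -- ### the family, the bump, the coordinate, the rectangles
  set G : ℝ × (Metric.sphere (0 : EuclideanSpace ℝ (Fin 2)) 1) → V := fun p => g p.2 with hGdef
  set β : (Metric.sphere (0 : EuclideanSpace ℝ (Fin 2)) 1) → ℝ := angBump c α (2 * α) with hβdef
  set ρ : ℝ × (Metric.sphere (0 : EuclideanSpace ℝ (Fin 2)) 1) → ℝ := fun p => β p.2 with hρdef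
  set ℓ : (Metric.sphere (0 : EuclideanSpace ℝ (Fin 2)) 1) → ℝ := angSin c with hℓdef
  set R : Set (ℝ × (Metric.sphere (0 : EuclideanSpace ℝ (Fin 2)) 1)) := univ ×ˢ circleArc c (3 * α) with hRdef
  set K : Set (ℝ × (Metric.sphere (0 : EuclideanSpace ℝ (Fin 2)) 1)) := univ ×ˢ circleClosedArc c α with hKdef
  have hG : ContMDiff (𝓘(ℝ, ℝ).prod (𝓡 1)) (𝓡 n) ∞ G := hg.comp contMDiff_snd
  have hβs : ContMDiff (𝓡 1) 𝓘(ℝ, ℝ) ∞ β := contMDiff_angBump c α (2 * α)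
  have hρs : ContMDiff (𝓘(ℝ, ℝ).prod (𝓡 1)) 𝓘(ℝ, ℝ) ∞ ρ := hβs.comp contMDiff_snd
  have hℓs : ContMDiff (𝓡 1) 𝓘(ℝ, ℝ) ∞ ℓ := contMDiff_angSin c
  have hRo : IsOpen R := isOpen_univ.prod (isOpen_circleArc _ _)
  have hβsupp : ∀ u, β u ≠ 0 → u ∈ circleArc c (2 * α) := fun u hu => by
    by_contra hnot
    rw [mem_circleArc, not_lt] at hnot
    exact hu (angBump_eq_zero hcos2 hnot)
  have hsuppR : tsupport ρ ⊆ R := by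
    have h1 : tsupport ρ ⊆ univ ×ˢ circleClosedArc c (2 * α) := by
      refine closure_minimal ?_ (isClosed_univ.prod (isClosed_circleClosedArc _ _))
      intro p hp
      exact ⟨mem_univ _, circleArc_subset_carc _ _ (hβsupp p.2 (mem_support.1 hp))⟩
    exact h1.trans (prod_mono Subset.rfl (circleClosedArc_two_mul_subset hα h3α))
  have hKR : K ⊆ R := prod_mono Subset.rfl (circleClosedArc_subset_three_mul hα h3α)
  have hsrcR : MapsTo G R (chartAt (EuclideanSpace ℝ (Fin n)) x).source := fun p hp =>
    hRc (circleArc_subset_carc _ _ hp.2)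
  have hρK : ∀ p ∈ K, ρ p = 1 := fun p hp => angBump_eq_one hcos2 hp.2
  have hρ0 : ∀ p, p ∉ R → ρ p = 0 := fun p hp => by
    by_contra h
    exact hp (hsuppR (subset_tsupport _ (mem_support.2 h)))
  have habsρ : ∀ p, |ρ p| ≤ 1 := fun p => by
    rw [abs_of_nonneg (angBump_nonneg _ _ _ _)]
    exact angBump_le_one _ _ _ _
  have habsℓ : ∀ u, |ℓ u| ≤ 1 := fun u => abs_angSin_le_one c u
  have hnotK : ∀ p, ρ p = 0 → p ∉ K := fun p h hK => by
    have := hρK p hK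
    rw [h] at this
    exact zero_ne_one this
  have hmemB : ∀ p : ℝ × (Metric.sphere (0 : EuclideanSpace ℝ (Fin 2)) 1), p ∈ univ ×ˢ (B ∪ circleClosedArc c α) → ρ p = 0 → p.2 ∈ B :=
    fun p hp h => hp.2.resolve_right fun hK => hnotK p h ⟨mem_univ _, hK⟩
  obtain ⟨hB1, hB2⟩ := stagesGoodOn_const_iff.1 hB
  -- ### margins (on the compact slice `{0} × circleClosedArc c (3α)`)
  set Rc0 : Set (ℝ × (Metric.sphere (0 : EuclideanSpace ℝ (Fin 2)) 1)) := ({0} : Set ℝ) ×ˢ circleClosedArc c (3 * α) with hRc0def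
  have hRc0c : IsCompact Rc0 := isCompact_singleton.prod (isCompact_circleClosedArc _ _)
  have hRc0src : MapsTo G Rc0 (chartAt (EuclideanSpace ℝ (Fin n)) x).source := fun p hp => hRc hp.2
  obtain ⟨ε₀, hε₀, hε₀P⟩ := exists_pos_forall_add_mem hG.continuous hRc0c hRc0src
    (isOpen_extChartAt_target (I := 𝓡 n) x) fun p hp =>
      (extChartAt (𝓡 n) x).map_source (by rw [extChartAt_source]; exact hRc hp.2)
  have hεi : ∀ i, ∃ ε : ℝ, 0 < ε ∧ ∀ p ∈ ({0} : Set ℝ) ×ˢ (C i ∩ circleClosedArc c (3 * α)),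
      ∀ y : EuclideanSpace ℝ (Fin n), ‖y‖ ≤ ε → extChartAt (𝓡 n) x (G p) + y ∈
        (extChartAt (𝓡 n) x).target ∩ (extChartAt (𝓡 n) x).symm ⁻¹' U i := by
    intro i
    refine exists_pos_forall_add_mem hG.continuous
      (isCompact_singleton.prod ((hC i).inter_right (isClosed_circleClosedArc _ _)))
      (fun p hp => hRc hp.2.2)
      ((continuousOn_extChartAt_symm x).isOpen_inter_preimage (isOpen_extChartAt_target x) (hU i))
      fun p hp => ⟨(extChartAt (𝓡 n) x).map_source (by rw [extChartAt_source]; exact hRc hp.2.2),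
        ?_⟩
    rw [mem_preimage, (extChartAt (𝓡 n) x).left_inv (by rw [extChartAt_source]; exact hRc hp.2.2)]
    exact hCU i hp.2.1
  choose εi hεi_pos hεiP using hεi
  obtain ⟨ε, ⟨hεle0, hεlei⟩, hεpos⟩ : ∃ ε : ℝ, (ε ≤ ε₀ ∧ ∀ i, ε ≤ εi i) ∧ 0 < ε := by
    have h1 : ∀ᶠ ε in 𝓝[>] (0 : ℝ), ε ≤ ε₀ := by
      filter_upwards [Ioc_mem_nhdsGT hε₀] with ε hε using hε.2
    have h2 : ∀ᶠ ε in 𝓝[>] (0 : ℝ), ∀ i, ε ≤ εi i :=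
      eventually_all.2 fun i => by
        filter_upwards [Ioc_mem_nhdsGT (hεi_pos i)] with ε hε using hε.2
    exact ((h1.and h2).and self_mem_nhdsWithin).exists
  -- ### lifted one-variable functions
  set gl : ℝ → EuclideanSpace ℝ (Fin n) := fun θ => extChartAt (𝓡 n) x (g (circlePoint θ)) with hgldef
  set βl : ℝ → ℝ := fun θ => β (circlePoint θ) with hβldef
  set ℓl : ℝ → ℝ := fun θ => ℓ (circlePoint θ) with hℓldef
  set PA : Set ℝ := {θ | circlePoint θ ∈ circleArc c (3 * α)} with hPAdef
  set Sl : Set ℝ := {θ | g (circlePoint θ) ∈ (chartAt (EuclideanSpace ℝ (Fin n)) x).source} with hSldef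
  have hPASl : PA ⊆ Sl := fun θ hθ => hRc (circleArc_subset_carc _ _ hθ)
  have hPAo : IsOpen PA := (isOpen_circleArc _ _).preimage continuous_circlePoint
  have hSlo : IsOpen Sl := isOpen_setOf_comp_circlePoint_mem_source hg.continuous x
  have hβld : ContDiff ℝ ∞ βl := contMDiff_iff_contDiff.1 (hβs.comp contMDiff_circlePoint)
  have hℓld : ContDiff ℝ ∞ ℓl := by
    rw [hℓldef, hℓdef, angSin_comp_circlePoint]
    exact Real.contDiff_sin.comp (contDiff_id.sub contDiff_const)
  have hℓl_apply : ∀ θ, ℓl θ = Real.sin (θ - c) := fun θ => angSin_circlePoint c θ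
  have hDℓl : ∀ θ, deriv ℓl θ = Real.cos (θ - c) := fun θ =>
    (hasDerivAt_angSin_comp_circlePoint c θ).deriv
  have hgld : ContDiffOn ℝ ∞ gl Sl := contDiffOn_extChartAt_comp_circlePoint hg x
  have hDgld : ContDiffOn ℝ ∞ (deriv gl) Sl := by
    have h := (hgld.fderiv_of_isOpen hSlo (m := ∞) (by simp)).clm_apply contDiffOn_const
      (g := fun _ => (1 : ℝ))
    exact h
  have hβd : Differentiable ℝ βl := hβld.differentiable (by simp)
  have hℓd : Differentiable ℝ ℓl := hℓld.differentiable (by simp)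
  have hDβd : Differentiable ℝ (deriv βl) :=
    ((hβld.fderiv_right (m := ∞) (by simp)).clm_apply contDiff_const
      (g := fun _ => (1 : ℝ))).differentiable (by simp)
  have hDℓd : Differentiable ℝ (deriv ℓl) :=
    ((hℓld.fderiv_right (m := ∞) (by simp)).clm_apply contDiff_const
      (g := fun _ => (1 : ℝ))).differentiable (by simp)
  have hgd : DifferentiableOn ℝ gl Sl := hgld.differentiableOn (by simp)
  have hDgd : DifferentiableOn ℝ (deriv gl) Sl := hDgld.differentiableOn (by simp)
  set aF : ℝ → ℝ := deriv βl with haFdef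
  set bF : ℝ → ℝ := fun θ => deriv βl θ * ℓl θ + βl θ * deriv ℓl θ with hbFdef
  have haFd : Differentiable ℝ aF := hDβd
  have hbFd : Differentiable ℝ bF := (hDβd.mul hℓd).add (hβd.mul hDℓd)
  -- ### the three null sets (parameters of dimension `1` and `2 < n`)
  set μ : Measure (EuclideanSpace ℝ (Fin n) × EuclideanSpace ℝ (Fin n)) := (volume : Measure (EuclideanSpace ℝ (Fin n))).prod volume with hμ
  have hdim1 : Module.finrank ℝ ℝ < Module.finrank ℝ (EuclideanSpace ℝ (Fin n)) := by
    rw [Module.finrank_self, finrank_euclideanSpace_fin]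
    omega
  have hdim2 : Module.finrank ℝ (ℝ × ℝ) < Module.finrank ℝ (EuclideanSpace ℝ (Fin n)) := by
    rw [Module.finrank_prod, Module.finrank_self, finrank_euclideanSpace_fin]
    omega
  set BadA : Set (EuclideanSpace ℝ (Fin n) × EuclideanSpace ℝ (Fin n)) := {q | ∃ θ ∈ PA, (aF θ ≠ 0 ∨ bF θ ≠ 0) ∧
    aF θ • q.1 + bF θ • q.2 = -(deriv gl θ)} with hBadA
  have hBadA0 : μ BadA = 0 :=
    addHaar_setOf_exists_smul_add_smul_eq μ hdim1 haFd.differentiableOn hbFd.differentiableOn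
      ((hDgd.mono hPASl).neg)
  set PB : Set (ℝ × ℝ) := {zz | zz.1 ∈ PA ∧ zz.2 ∈ PA} with hPBdef
  set BadB : Set (EuclideanSpace ℝ (Fin n) × EuclideanSpace ℝ (Fin n)) := {q | ∃ zz ∈ PB,
    (βl zz.1 - βl zz.2 ≠ 0 ∨ βl zz.1 * ℓl zz.1 - βl zz.2 * ℓl zz.2 ≠ 0) ∧
      (βl zz.1 - βl zz.2) • q.1 + (βl zz.1 * ℓl zz.1 - βl zz.2 * ℓl zz.2) • q.2 =
        gl zz.2 - gl zz.1} with hBadB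
  have hBadB0 : μ BadB = 0 := by
    refine addHaar_setOf_exists_smul_add_smul_eq μ hdim2 ?_ ?_ ?_
    · exact ((hβd.comp differentiable_fst).sub (hβd.comp differentiable_snd)).differentiableOn
    · exact (((hβd.comp differentiable_fst).mul (hℓd.comp differentiable_fst)).sub
        ((hβd.comp differentiable_snd).mul (hℓd.comp differentiable_snd))).differentiableOn
    · exact (hgd.comp differentiableOn_snd fun zz hzz => hPASl hzz.2).sub
        (hgd.comp differentiableOn_fst fun zz hzz => hPASl hzz.1)
  set PC : Set (ℝ × ℝ) := {zz | zz.1 ∈ PA ∧ zz.2 ∈ Sl} with hPCdef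
  set BadC : Set (EuclideanSpace ℝ (Fin n) × EuclideanSpace ℝ (Fin n)) := {q | ∃ zz ∈ PC, (βl zz.1 ≠ 0 ∨ βl zz.1 * ℓl zz.1 ≠ 0) ∧
    βl zz.1 • q.1 + (βl zz.1 * ℓl zz.1) • q.2 = gl zz.2 - gl zz.1} with hBadC
  have hBadC0 : μ BadC = 0 := by
    refine addHaar_setOf_exists_smul_add_smul_eq μ hdim2 ?_ ?_ ?_
    · exact (hβd.comp differentiable_fst).differentiableOn
    · exact ((hβd.comp differentiable_fst).mul (hℓd.comp differentiable_fst)).differentiableOn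
    · exact (hgd.comp differentiableOn_snd fun zz hzz => hzz.2).sub
        (hgd.comp differentiableOn_fst fun zz hzz => hPASl hzz.1)
  -- ### choice of the parameter
  set O : Set (EuclideanSpace ℝ (Fin n) × EuclideanSpace ℝ (Fin n)) := {q | ‖q.1‖ + ‖q.2‖ < ε} with hOdef
  have hOo : IsOpen O := isOpen_lt (continuous_fst.norm.add continuous_snd.norm) continuous_const
  have h0O : (0 : EuclideanSpace ℝ (Fin n) × EuclideanSpace ℝ (Fin n)) ∈ O := by
    simp only [hOdef, mem_setOf_eq, Prod.fst_zero, Prod.snd_zero, norm_zero, add_zero]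
    exact hεpos
  obtain ⟨q, hqO, hqBad⟩ := exists_mem_notMem_of_measure_zero μ hOo ⟨0, h0O⟩
    (measure_union_null (measure_union_null hBadA0 hBadB0) hBadC0)
  refine ⟨q, ?_⟩
  -- ### smallness consequences
  have hsmall : ∀ p : ℝ × (Metric.sphere (0 : EuclideanSpace ℝ (Fin 2)) 1), ‖ρ p • (q.1 + ℓ p.2 • q.2)‖ ≤ ε := fun p =>
    (norm_smul_add_smul_le (habsρ p) (habsℓ p.2) _ _).trans hqO.le
  have htgt : ∀ p ∈ R, extChartAt (𝓡 n) x (G p) + ρ p • (q.1 + ℓ p.2 • q.2) ∈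
      (extChartAt (𝓡 n) x).target := fun p hp => by
    have h := hε₀P (0, p.2) ⟨rfl, circleArc_subset_carc _ _ hp.2⟩ _ ((hsmall p).trans hεle0)
    exact h
  set G' : ℝ × (Metric.sphere (0 : EuclideanSpace ℝ (Fin 2)) 1) → V := chartPerturb G x ρ ℓ q with hG'def
  have hG's : ContMDiff (𝓘(ℝ, ℝ).prod (𝓡 1)) (𝓡 n) ∞ G' :=
    contMDiff_chartPerturb hG hρs hℓs hRo hsuppR hsrcR htgt
  have hG'R : ∀ p ∈ R, G' p ∈ (chartAt (EuclideanSpace ℝ (Fin n)) x).source ∧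
      extChartAt (𝓡 n) x (G' p) = extChartAt (𝓡 n) x (G p) + ρ p • (q.1 + ℓ p.2 • q.2) :=
    fun p hp => chartPerturb_mem_source (hsrcR hp) (htgt p hp)
  have hG'off : ∀ p, p ∉ R → G' p = G p := fun p hp => chartPerturb_of_eq_zero (hρ0 p hp)
  have hG't : ∀ t u, G' (t, u) = G' (0, u) := fun t u => rfl
  have hG'fun : (fun p : ℝ × (Metric.sphere (0 : EuclideanSpace ℝ (Fin 2)) 1) => G' (0, p.2)) = G' := by
    funext p
    exact (hG't p.1 p.2).symm
  -- smoothness of the perturbed circle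
  have hg's : ContMDiff (𝓡 1) (𝓡 n) ∞ fun u : (Metric.sphere (0 : EuclideanSpace ℝ (Fin 2)) 1) => G' (0, u) :=
    hG's.comp (contMDiff_const.prodMk contMDiff_id)
  have hcoordL : ∀ θ ∈ PA, extChartAt (𝓡 n) x (G' (0, circlePoint θ)) =
      gl θ + βl θ • (q.1 + ℓl θ • q.2) := fun θ hθ => (hG'R (0, circlePoint θ) ⟨mem_univ _, hθ⟩).2
  refine ⟨hg's, ?_, ?_, fun u hu => chartPerturb_of_eq_zero (ρ := ρ) hu⟩
  · -- ### good stages on `ℝ × (B ∪ circleClosedArc c α)`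
    rw [hG'fun]
    refine ⟨?_, ?_⟩
    · -- nonvanishing velocity
      intro t s hts
      rw [thetaVel_eq_of_stage_eq (G := G') (G' := G') (t := t) (t' := 0) (fun u => hG't t u) s]
      by_cases hpR : ((0 : ℝ), circlePoint s) ∈ R
      · have hz : s ∈ PA := hpR.2
        have hsrc' : G' (0, circlePoint s) ∈ (chartAt (EuclideanSpace ℝ (Fin n)) x).source := (hG'R _ hpR).1
        intro h0
        have h1 := (thetaVel_eq_zero_iff_deriv_eq_zero hG's hsrc').1 h0
        -- the coordinate curve of `G'` near `s` is `gl + βl • (v + ℓl • w)`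
        have hev : (fun r : ℝ => extChartAt (𝓡 n) x (G' (0, circlePoint r))) =ᶠ[𝓝 s]
            fun r => gl r + βl r • (q.1 + ℓl r • q.2) := by
          filter_upwards [hPAo.mem_nhds hz] with r hr
          exact hcoordL r hr
        rw [hev.deriv_eq] at h1
        have hgl_d : DifferentiableAt ℝ gl s :=
          hgd.differentiableAt (hSlo.mem_nhds (hPASl hz))
        have hpt_d : DifferentiableAt ℝ (fun r => βl r • (q.1 + ℓl r • q.2)) s :=
          differentiableAt_smul_add_smul_real (hβd s) (hℓd s) q.1 q.2
        rw [show (fun r => gl r + βl r • (q.1 + ℓl r • q.2)) =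
            gl + fun r => βl r • (q.1 + ℓl r • q.2) from rfl, deriv_add hgl_d hpt_d,
          deriv_smul_add_smul (hβd s) (hℓd s)] at h1
        -- `h1 : deriv gl s + (aF s • v + bF s • w) = 0`
        by_cases hgrip : aF s ≠ 0 ∨ bF s ≠ 0
        · exact hqBad (Or.inl (Or.inl ⟨s, hz, hgrip, eq_neg_of_add_eq_zero_right h1⟩))
        · rw [not_or, not_not, not_not] at hgrip
          obtain ⟨ha0, hb0⟩ := hgrip
          have hcos : 0 < Real.cos (s - c) := cos_sub_pos_of_circlePoint_mem_circleArc h3α hα hpR.2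
          have hβz : βl s = 0 := by
            have hb : deriv βl s * ℓl s + βl s * deriv ℓl s = 0 := hb0
            have ha : deriv βl s = 0 := ha0
            rw [ha, zero_mul, zero_add, hDℓl] at hb
            exact (mul_eq_zero.1 hb).resolve_right hcos.ne'
          have hsB : circlePoint s ∈ B := hmemB (0, circlePoint s) hts hβz
          refine hB1 s hsB ((thetaVel_eq_zero_iff_deriv_eq_zero hG (hsrcR hpR)).2 ?_)
          have ha : deriv βl s = 0 := ha0
          have hb : deriv βl s * ℓl s + βl s * deriv ℓl s = 0 := hb0
          rw [hb, ha, zero_smul, zero_smul, add_zero, add_zero] at h1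
          exact h1
      · have hev : G' =ᶠ[𝓝 (((0 : ℝ), circlePoint s) : ℝ × (Metric.sphere (0 : EuclideanSpace ℝ (Fin 2)) 1))] G :=
          chartPerturb_eventuallyEq fun h => hpR (hsuppR h)
        rw [thetaVel_congr_of_eventuallyEq hev]
        exact hB1 s (hmemB _ hts (hρ0 _ hpR))
    · -- separation of the points of `B ∪ circleClosedArc c α`
      intro t u u' hp heq
      change G' (t, u) = G' (t, u') at heq
      rw [hG't t u, hG't t u'] at heq
      by_contra hne
      have fallback : ρ (0, u) = 0 → G' (0, u') = G (0, u') → False := fun h0 h1 => by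
        have hGeq : g u = g u' := by
          change G (0, u) = G (0, u')
          rw [← chartPerturb_of_eq_zero (G := G) (x := x) (ℓ := ℓ) (q := q) h0, ← h1]
          exact heq
        exact hne (hB2 u u' (hmemB (t, u) hp h0) hGeq)
      by_cases hpR : (((0 : ℝ), u) : ℝ × (Metric.sphere (0 : EuclideanSpace ℝ (Fin 2)) 1)) ∈ R
      · obtain ⟨θ, hθI, hθu⟩ := exists_lift_of_mem_circleArc_three_mul hα h3α (u := u) hpR.2
        have hz : θ ∈ PA := by
          change circlePoint θ ∈ circleArc c (3 * α)
          rw [hθu]; exact hpR.2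
        have hρu : ρ (0, u) = βl θ := by
          change β u = β (circlePoint θ)
          rw [hθu]
        by_cases hp'R : (((0 : ℝ), u') : ℝ × (Metric.sphere (0 : EuclideanSpace ℝ (Fin 2)) 1)) ∈ R
        · obtain ⟨θ', hθ'I, hθ'u⟩ := exists_lift_of_mem_circleArc_three_mul hα h3α (u := u') hp'R.2
          have hz' : θ' ∈ PA := by
            change circlePoint θ' ∈ circleArc c (3 * α)
            rw [hθ'u]; exact hp'R.2
          have hρu' : ρ (0, u') = βl θ' := by
            change β u' = β (circlePoint θ')
            rw [hθ'u]
          have hθθ' : θ ≠ θ' := fun h => hne (by rw [← hθu, ← hθ'u, h])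
          have hE : gl θ + βl θ • (q.1 + ℓl θ • q.2) = gl θ' + βl θ' • (q.1 + ℓl θ' • q.2) := by
            rw [← hcoordL _ hz, ← hcoordL _ hz', hθu, hθ'u, heq]
          have hE2 := sub_smul_add_sub_smul_eq hE
          by_cases hgrip : βl θ - βl θ' ≠ 0 ∨ βl θ * ℓl θ - βl θ' * ℓl θ' ≠ 0
          · exact hqBad (Or.inl (Or.inr ⟨(θ, θ'), ⟨hz, hz'⟩, hgrip, hE2⟩))
          · rw [not_or, not_not, not_not, sub_eq_zero, sub_eq_zero] at hgrip
            obtain ⟨h1, h2⟩ := hgrip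
            have hβz : βl θ = 0 := by
              by_contra hβne
              rw [← h1] at h2
              have hℓeq : ℓl θ = ℓl θ' := mul_left_cancel₀ hβne h2
              rw [hℓl_apply, hℓl_apply] at hℓeq
              exact hθθ' (eq_of_sin_sub_eq hθI hθ'I hℓeq)
            have hβz' : βl θ' = 0 := h1 ▸ hβz
            exact fallback (hρu.trans hβz) (chartPerturb_of_eq_zero (hρu'.trans hβz'))
        · have hG'p' : G' (0, u') = G (0, u') := hG'off _ hp'R
          by_cases hsrc' : g u' ∈ (chartAt (EuclideanSpace ℝ (Fin n)) x).source
          · obtain ⟨θ'', hθ''⟩ := circlePoint_surjective u'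
            have hzz : ((θ, θ'') : ℝ × ℝ) ∈ PC := by
              refine ⟨hz, ?_⟩
              change g (circlePoint θ'') ∈ (chartAt (EuclideanSpace ℝ (Fin n)) x).source
              rw [hθ'']; exact hsrc'
            have hE : gl θ + βl θ • (q.1 + ℓl θ • q.2) = gl θ'' := by
              rw [← hcoordL _ hz, hθu, heq, hG'p']
              change extChartAt (𝓡 n) x (g u') = extChartAt (𝓡 n) x (g (circlePoint θ''))
              rw [hθ'']
            have hE2 := smul_add_smul_eq_sub hE
            by_cases hβne : βl θ ≠ 0
            · exact hqBad (Or.inr ⟨(θ, θ''), hzz, Or.inl hβne, hE2⟩)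
            · rw [not_not] at hβne
              exact fallback (hρu.trans hβne) hG'p'
          · refine hsrc' ?_
            change G (0, u') ∈ (chartAt (EuclideanSpace ℝ (Fin n)) x).source
            rw [← hG'p', ← heq]
            exact (hG'R _ hpR).1
      · have hρu : ρ (0, u) = 0 := hρ0 _ hpR
        have hG'p : G' (0, u) = G (0, u) := hG'off _ hpR
        by_cases hp'R : (((0 : ℝ), u') : ℝ × (Metric.sphere (0 : EuclideanSpace ℝ (Fin 2)) 1)) ∈ R
        · by_cases hsrc : g u ∈ (chartAt (EuclideanSpace ℝ (Fin n)) x).source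
          · obtain ⟨θ', hθ'I, hθ'u⟩ :=
              exists_lift_of_mem_circleArc_three_mul hα h3α (u := u') hp'R.2
            have hz' : θ' ∈ PA := by
              change circlePoint θ' ∈ circleArc c (3 * α)
              rw [hθ'u]; exact hp'R.2
            have hρu' : ρ (0, u') = βl θ' := by
              change β u' = β (circlePoint θ')
              rw [hθ'u]
            obtain ⟨θ'', hθ''⟩ := circlePoint_surjective u
            have hzz : ((θ', θ'') : ℝ × ℝ) ∈ PC := by
              refine ⟨hz', ?_⟩
              change g (circlePoint θ'') ∈ (chartAt (EuclideanSpace ℝ (Fin n)) x).source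
              rw [hθ'']; exact hsrc
            have hE : gl θ' + βl θ' • (q.1 + ℓl θ' • q.2) = gl θ'' := by
              rw [← hcoordL _ hz', hθ'u, ← heq, hG'p]
              change extChartAt (𝓡 n) x (g u) = extChartAt (𝓡 n) x (g (circlePoint θ''))
              rw [hθ'']
            have hE2 := smul_add_smul_eq_sub hE
            by_cases hβne : βl θ' ≠ 0
            · exact hqBad (Or.inr ⟨(θ', θ''), hzz, Or.inl hβne, hE2⟩)
            · rw [not_not] at hβne
              exact fallback hρu (chartPerturb_of_eq_zero (hρu'.trans hβne))
          · refine hsrc ?_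
            change G (0, u) ∈ (chartAt (EuclideanSpace ℝ (Fin n)) x).source
            rw [← hG'p, heq]
            exact (hG'R _ hp'R).1
        · exact fallback hρu (hG'off _ hp'R)
  · -- ### the constraints `C i ↦ U i`
    intro i u huC
    change G' (0, u) ∈ U i
    by_cases hρp : ρ (0, u) = 0
    · rw [hG'def, chartPerturb_of_eq_zero hρp]
      exact hCU i huC
    · have hpR : (((0 : ℝ), u) : ℝ × (Metric.sphere (0 : EuclideanSpace ℝ (Fin 2)) 1)) ∈ R := hsuppR (subset_tsupport _ (mem_support.2 hρp))
      obtain ⟨-, hyU⟩ := hεiP i (0, u) ⟨rfl, huC, circleArc_subset_carc _ _ hpR.2⟩ _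
        ((hsmall (0, u)).trans (hεlei i))
      rw [hG'def, chartPerturb_eq_of_mem_source (hsrcR hpR)]
      exact hyU

end Step

end Literature.Topology.FourManifolds
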